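import Summits.BirchSwinnertonDyer.BirchSwinnertonDyer.Theorems.ManinLocalTwoThreeCDivisionCuspGerm
import Literature.NumberTheory.EllipticCurves.WeierstrassTransformation
import HarnessLib

/-!
# The `c`-division point SHIFTED BY A HALF-PERIOD: the `q`-germs of `𝕢²·12℘_{Λ_W}(ℰ_f)` and of `12℘_{Λ_W}(ℰ_f + κ)`
(route `ManinLocalTwoThree`, crux C2 `ManinOddAtFour` stmt-BirchSwinnertonDyer-22967; cell bsd-f2-manin, prover p3 gen 19;
first brick of the kernel port of -an's row E-an-152d `IndexFourForcesFullRationalTwoTorsion` in the `2 ∣ c₀` form met by the line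
`cdivision_udc`: index `4` ∧ `|c₀| = 2` ⟹ full rational `2`-torsion)

In the index-`4` configuration the `c`-division witness `F = 12·℘_{Λ_W}(ℰ_f)·G·Δ^a` (tree `CDivision.exists_cDivisionWitnessCore`) has
FOUR `Γ₀(N)`-translates `F ∣ γ_κ = 12·℘_{Λ_W}(ℰ_f + κ)·G·Δ^a`, `κ ∈ Λ₀(f)/Λ_W ≅ (ℤ/2)²` a half-period of `Λ_W`.  This file computes
their `q`-expansions at `i∞` as EXPLICIT formal series in `e_κ = ℘_{Λ_W}(κ)` with rational structure constants — the input of the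
Galois (`Aut ℂ`) argument that makes the three `2`-torsion abscissae `e_κ − b₂/12` rational:
* `exists_qGerm_sq_mul_twelve_weierstrassP` — an analytic `q`-germ `T` with `T(0) = 12`, INTEGER Taylor series `P` and
  `T(𝕢τ) = 𝕢τ²·12℘_{Λ_W}(ℰ_f τ)` high in the cusp (repackaging of the tree's N7 core `CDivCuspGerm.exists_hasSum_qParam_sq_mul_x`:
  Honda at the multiplier `1`);
* `map_inv_eq_inv_map` — `PowerSeries.map` commutes with inversion of a series with invertible constant term;
* `exists_halfPeriodSeries` — a family `S : ℂ → ℂ⟦X⟧`, `S(e) = 12e + (432e² − 36g₂)·X²·(P − 12e·X²)⁻¹` (`g₂ = c₄/12 ∈ ℚ`), with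
  `(S e).map σ = S (σ e)` for EVERY ring endomorphism `σ` of `ℂ`, constant term `12e`, and for every half-period `κ` of `Λ_W`
  (`κ ∉ Λ_W`, `2κ ∈ Λ_W`): `Σ (S e_κ)ₙ 𝕢τⁿ = 12·℘_{Λ_W}(ℰ_f τ + κ)` for `Im τ` large — by the half-period addition formula
  `℘(u + κ) = e_κ + (3e_κ² − g₂/4)/(℘(u) − e_κ)` (tree `PeriodPair.weierstrassP_sub_halfPeriod`, Lawden (6.8.11)).
HONEST FRAMING: analytic bookkeeping only; E-an-152d, C2, Manin's conjecture and BSD are NOT proved in this file.  No definitions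
(the family `S` is produced existentially), no sorry. [cite: Lawden1989, §6.8 eq. (6.8.11)] [cite: Honda1970, Thm. 9] [cite: SilvermanAEC2009, IV.1]
-/

set_option autoImplicit false
-- lint-debt: the directory name repeats the summit name (sibling precedent `ManinLocalTwoThreeCDivisionCuspGerm.lean`)
set_option linter.dupNamespace false

noncomputable section

open scoped Topology PeriodPair MatrixGroups
open Complex Filter PowerSeries CongruenceSubgroup
open UpperHalfPlane hiding I
open WeierstrassCurve Literature.NumberTheory.EllipticCurves Literature.NumberTheory.EllipticCurves.ModularForms
open Summit.BirchSwinnertonDyer.Rank1Residual.ManinAdditive.CuspidalKummer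
open Summit.BirchSwinnertonDyer.Rank1Residual.ManinAdditive.CuspidalKummerThree
open Summit.BirchSwinnertonDyer.BirchSwinnertonDyer.Theorems.ManinLocalTwoThree.KummerCubeAnalytic
open Summit.BirchSwinnertonDyer.BirchSwinnertonDyer.Theorems.ManinLocalTwoThree.HalvingParam

namespace Summit.BirchSwinnertonDyer.BirchSwinnertonDyer.Theorems.ManinLocalTwoThree.CDivTranslate

/-! ## §1 The germ of `𝕢²·12℘_{Λ_W}(ℰ_f)` -/

/-- **The analytic `q`-germ of `𝕢²·12℘_{Λ_W}(ℰ_f)`**: there are an analytic germ `T` at `q = 0` with `T(0) = 12`, an INTEGER power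
series `P` with `𝓣[T] = P`, and `B` such that for `Im τ > B`: `ℰ_f τ ∉ Λ_W` and `T(𝕢τ) = 𝕢τ²·12℘_{Λ_W}(ℰ_f τ)` (the germ behind the
tree's N7 core; `P = 12·(X²x)_W(exp_W ℓ)·U⁻² + b₂X²`, Honda at the multiplier `1`). [cite: Honda1970, Thm. 9] [cite: SilvermanAEC2009, IV.1] -/
theorem exists_qGerm_sq_mul_twelve_weierstrassP (W : WeierstrassCurve ℚ) [W.IsElliptic] [W.IsGloballyMinimal] {N : ℕ} [NeZero N]
    (D : ModularParametrizationData W N) :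
    ∃ (T : ℂ → ℂ) (P : ℤ⟦X⟧) (B : ℝ), AnalyticAt ℂ T 0 ∧ T 0 = 12 ∧ taylorAt0 T = P.map (Int.castRingHom ℂ) ∧
      ∀ τ : ℍ, B < τ.im → eichlerIntegral D.f τ ∉ D.L.lattice ∧
        T (Function.Periodic.qParam 1 (τ : ℂ)) =
          Function.Periodic.qParam 1 (τ : ℂ) ^ 2 * (12 * ℘[D.L] (eichlerIntegral D.f τ)) := by
  classical
  set V := W.baseChange ℂ with hV
  set a : ℕ → ℤ := fun n ↦ W.LFunction n with hadef
  have ha : ∀ n, (a n : ℂ) = cuspCoeff D.f n := fun n ↦ by rw [D.isNewformOf.2 n]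
  have hf1 : cuspCoeff D.f 1 = 1 := D.isNewformOf.1.2.2
  -- the two germs
  obtain ⟨G, hGan, hG0, hTG, hGval⟩ := CDivCuspGerm.exists_qGerm_locG W D a ha
  obtain ⟨Z, hZan, hZ0, hTZ, hZval⟩ := exists_qGerm_locT_intMul W D a ha 1
  obtain ⟨P, U, hU1, hZU, hPU⟩ := CDivCuspGerm.exists_intSeries_taylor_xGerm W D a ha
  simp only [Int.cast_one, one_smul] at hTZ
  -- `Z = q·Uf`, `Uf := dslope Z 0` analytic with `Uf 0 = 1`
  set Uf : ℂ → ℂ := dslope Z 0 with hUf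
  have hZq : ∀ q, Z q = q * Uf q := fun q ↦ by
    have h := sub_smul_dslope Z 0 q
    rw [sub_zero, hZ0, sub_zero, smul_eq_mul] at h
    exact h.symm
  have hUfan : AnalyticAt ℂ Uf 0 := by
    obtain ⟨p, hp⟩ := hZan
    exact ⟨_, hp.has_fpower_series_dslope_fslope⟩
  have hTUmap : taylorAt0 Uf = (U.map (Int.castRingHom ℚ)).map (algebraMap ℚ ℂ) := by
    have h1 : taylorAt0 Z = X * taylorAt0 Uf := by
      have hfun : Z = (fun q : ℂ ↦ q) * Uf := by funext q; rw [Pi.mul_apply]; exact hZq q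
      have hid : AnalyticAt ℂ (fun q : ℂ ↦ q) 0 := analyticAt_id
      have h := congrArg taylorAt0 hfun
      simp only [taylorAt0] at h ⊢
      rw [Literature.NumberTheory.Transcendental.AndreCriterion.taylor_mul hid hUfan] at h
      rw [h]
      congr 1
      exact taylorAt0_id
    have h2 : taylorAt0 Z = X * (U.map (Int.castRingHom ℚ)).map (algebraMap ℚ ℂ) := by
      rw [hTZ, hZU, map_mul, map_X]
    exact mul_left_cancel₀ X_ne_zero (h1.symm.trans h2)
  have hUf0 : Uf 0 = 1 := by
    have h := constantCoeff_taylorAt0 Uf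
    rw [hTUmap, ← coeff_zero_eq_constantCoeff_apply, coeff_map, coeff_map, coeff_zero_eq_constantCoeff_apply, hU1] at h
    simpa using h.symm
  -- the germ `Xq := G/Uf²` of `𝕢²·(℘ − b₂/12)`
  set Xq : ℂ → ℂ := fun q ↦ G q / Uf q ^ 2 with hXq
  have hXqan : AnalyticAt ℂ Xq 0 := hGan.div (hUfan.pow 2) (by rw [hUf0]; norm_num)
  have hXq0 : Xq 0 = 1 := by
    show G 0 / Uf 0 ^ 2 = 1
    rw [hG0, hUf0]; norm_num
  have hTXq : taylorAt0 Xq = (P.map (Int.castRingHom ℚ)).map (algebraMap ℚ ℂ) := by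
    have hprod : taylorAt0 Xq * taylorAt0 Uf ^ 2 = taylorAt0 G := by
      have hUfne : ∀ᶠ q in 𝓝 (0 : ℂ), Uf q ≠ 0 := hUfan.continuousAt.eventually_ne (by rw [hUf0]; exact one_ne_zero)
      have hfun : G =ᶠ[𝓝 0] Xq * Uf ^ 2 := by
        filter_upwards [hUfne] with q hq
        rw [Pi.mul_apply, Pi.pow_apply, hXq]
        field_simp
      have h := Literature.NumberTheory.Transcendental.AndreCriterion.taylor_congr hfun
      simp only [taylorAt0] at h ⊢
      rw [Literature.NumberTheory.Transcendental.AndreCriterion.taylor_mul hXqan (hUfan.pow 2),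
        Literature.NumberTheory.Transcendental.AndreCriterion.taylor_pow hUfan 2] at h
      exact h.symm
    rw [hTUmap, hTG, ← hPU, map_mul, map_pow] at hprod
    have hUne : ((U.map (Int.castRingHom ℚ)).map (algebraMap ℚ ℂ)) ^ 2 ≠ 0 := by
      refine pow_ne_zero 2 fun h0 ↦ ?_
      have h := congrArg constantCoeff h0
      rw [← coeff_zero_eq_constantCoeff_apply, coeff_map, coeff_map, coeff_zero_eq_constantCoeff_apply, hU1, map_zero] at h
      simp at h
    exact mul_right_cancel₀ hUne hprod
  -- `b₂ ∈ ℤ`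
  have hb₂ : (W.b₂ : ℂ) = (((integralModelInt W).b₂ : ℤ) : ℂ) := by
    have h : W.b₂ = ((integralModelInt W).b₂ : ℚ) := by
      conv_lhs => rw [← map_integralModelInt W]
      rw [WeierstrassCurve.map_b₂]
      simp
    rw [h]
    push_cast
    rfl
  -- the germ `T := 12·Xq + b₂·q²`
  set T : ℂ → ℂ := fun q ↦ 12 * Xq q + (((integralModelInt W).b₂ : ℤ) : ℂ) * q ^ 2 with hT
  have hid : AnalyticAt ℂ (fun q : ℂ ↦ q) 0 := analyticAt_id
  have hsq : AnalyticAt ℂ (fun q : ℂ ↦ q ^ 2) 0 := hid.pow 2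
  have hA1 : AnalyticAt ℂ (fun q : ℂ ↦ (12 : ℂ) * Xq q) 0 := analyticAt_const.mul hXqan
  have hA2 : AnalyticAt ℂ (fun q : ℂ ↦ (((integralModelInt W).b₂ : ℤ) : ℂ) * q ^ 2) 0 := analyticAt_const.mul hsq
  have hTan : AnalyticAt ℂ T 0 := by
    show AnalyticAt ℂ (fun q : ℂ ↦ 12 * Xq q + (((integralModelInt W).b₂ : ℤ) : ℂ) * q ^ 2) 0
    exact hA1.add hA2
  have hTsq : taylorAt0 (fun q : ℂ ↦ q ^ 2) = X ^ 2 := by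
    have h : (fun q : ℂ ↦ q ^ 2) = (fun q : ℂ ↦ q) ^ 2 := by funext q; simp
    rw [h]
    simp only [taylorAt0]
    rw [Literature.NumberTheory.Transcendental.AndreCriterion.taylor_pow hid 2]
    have := taylorAt0_id
    simp only [taylorAt0] at this
    rw [this]
  have hTT : taylorAt0 T = (C (12 : ℤ) * P + C (integralModelInt W).b₂ * X ^ 2 : ℤ⟦X⟧).map (Int.castRingHom ℂ) := by
    have h1 : taylorAt0 (fun q : ℂ ↦ 12 * Xq q) = C (12 : ℂ) * taylorAt0 Xq := by
      simp only [taylorAt0]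
      exact Literature.NumberTheory.Transcendental.AndreCriterion.taylor_const_mul 12 Xq
    have h2 : taylorAt0 (fun q : ℂ ↦ (((integralModelInt W).b₂ : ℤ) : ℂ) * q ^ 2) =
        C ((((integralModelInt W).b₂ : ℤ) : ℂ)) * X ^ 2 := by
      rw [← hTsq]
      simp only [taylorAt0]
      exact Literature.NumberTheory.Transcendental.AndreCriterion.taylor_const_mul _ _
    have hadd : T = (fun q : ℂ ↦ 12 * Xq q) + fun q : ℂ ↦ (((integralModelInt W).b₂ : ℤ) : ℂ) * q ^ 2 := by
      funext q; simp [hT]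
    rw [hadd]
    have h := Literature.NumberTheory.Transcendental.AndreCriterion.taylor_add hA1 hA2
    simp only [taylorAt0] at h h1 h2 ⊢
    rw [h, h1, h2]
    simp only [taylorAt0] at hTXq
    rw [hTXq, map_add, map_mul, map_mul, map_pow, map_C, map_C, map_X]
    rfl
  -- near `q = 0`
  have hUfne' : ∀ᶠ q in 𝓝 (0 : ℂ), Uf q ≠ 0 := hUfan.continuousAt.eventually_ne (by rw [hUf0]; exact one_ne_zero)
  have hev : ∀ᶠ q in 𝓝[≠] (0 : ℂ), Uf q ≠ 0 ∧ qGerm D.f q ∉ D.L.lattice := by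
    filter_upwards [hUfne'.filter_mono nhdsWithin_le_nhds, eventually_qGerm_notMem D.f hf1 D.L] with q hq hqΛ
    exact ⟨hq, hqΛ⟩
  obtain ⟨B, hB⟩ := exists_im_bound_of_eventually hev
  refine ⟨T, C (12 : ℤ) * P + C (integralModelInt W).b₂ * X ^ 2, B, hTan, ?_, hTT, fun τ hτ ↦ ?_⟩
  · show 12 * Xq 0 + (((integralModelInt W).b₂ : ℤ) : ℂ) * (0 : ℂ) ^ 2 = 12
    rw [hXq0]; ring
  obtain ⟨hUq, hΛ⟩ := hB τ hτ
  set q := Function.Periodic.qParam 1 (τ : ℂ) with hq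
  have hEq : qGerm D.f q = eichlerIntegral D.f τ := qGerm_apply D.f τ
  rw [hEq] at hΛ
  refine ⟨hΛ, ?_⟩
  have hZval' : Z q = locT D.L V (eichlerIntegral D.f τ) := by simpa [hq] using hZval τ
  have hval : Xq q = q ^ 2 * (℘[D.L] (eichlerIntegral D.f τ) - (W.b₂ : ℂ) / 12) := by
    have hG := hGval τ
    rw [← hq, locG, if_neg hΛ, ← hZval'] at hG
    have hb₂' : V.b₂ = (W.b₂ : ℂ) := by rw [hV, WeierstrassCurve.baseChange, WeierstrassCurve.map_b₂]; rfl
    have hUq' : Uf q ≠ 0 := hUq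
    rw [hXq]
    simp only
    rw [hG, hZq q, hb₂']
    field_simp
  show 12 * Xq q + (((integralModelInt W).b₂ : ℤ) : ℂ) * q ^ 2 = q ^ 2 * (12 * ℘[D.L] (eichlerIntegral D.f τ))
  rw [hval, ← hb₂]
  ring


/-! ## §2 Two small tools: `map` commutes with inversion; from `Im τ` large to a punctured neighbourhood of `q = 0` -/

/-- `PowerSeries.map σ` commutes with inversion of a series with non-vanishing constant term (`σ` a ring endomorphism of `ℂ`,
injective since `ℂ` is a field). [folklore] -/
theorem map_inv_eq_inv_map (σ : ℂ →+* ℂ) (φ : ℂ⟦X⟧) (h : constantCoeff φ ≠ 0) :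
    (φ⁻¹).map σ = (φ.map σ)⁻¹ := by
  have h' : constantCoeff (φ.map σ) ≠ 0 := by
    rw [← coeff_zero_eq_constantCoeff_apply, coeff_map, coeff_zero_eq_constantCoeff_apply]
    exact (map_ne_zero_iff σ σ.injective).mpr h
  rw [PowerSeries.eq_inv_iff_mul_eq_one h', ← map_mul, PowerSeries.inv_mul_cancel φ h, map_one]

/-- From a statement high in the cusp (`Im τ > B`) to a statement on a punctured neighbourhood of `q = 0`
(`q = 𝕢₁τ` with `τ = (2πi)⁻¹ log q`, Mathlib `Function.Periodic.qParam_right_inv`). [folklore] -/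
theorem eventually_nhdsNE_of_forall_im_gt {P : ℂ → Prop} {B : ℝ}
    (h : ∀ τ : ℍ, B < τ.im → P (Function.Periodic.qParam 1 (τ : ℂ))) : ∀ᶠ q in 𝓝[≠] (0 : ℂ), P q := by
  set r : ℝ := min 1 (Real.exp (-2 * Real.pi * B)) with hr
  have hr0 : 0 < r := lt_min one_pos (Real.exp_pos _)
  have hball : ∀ q : ℂ, q ≠ 0 → ‖q‖ < r → P q := by
    intro q hq0 hqr
    have hq1 : ‖q‖ < 1 := hqr.trans_le (min_le_left _ _)
    have hqB : ‖q‖ < Real.exp (-2 * Real.pi * B) := hqr.trans_le (min_le_right _ _)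
    have hnorm : 0 < ‖q‖ := norm_pos_iff.mpr hq0
    set τ₀ : ℂ := Function.Periodic.invQParam 1 q with hτ₀
    have him : τ₀.im = -1 / (2 * Real.pi) * Real.log ‖q‖ := Function.Periodic.im_invQParam 1 q
    have hlog : Real.log ‖q‖ < 0 := Real.log_neg hnorm hq1
    have hπ : 0 < 2 * Real.pi := by positivity
    have him_pos : 0 < τ₀.im := by
      rw [him]
      have : -1 / (2 * Real.pi) * Real.log ‖q‖ = -(Real.log ‖q‖) / (2 * Real.pi) := by ring
      rw [this]
      exact div_pos (by linarith) hπ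
    have himB : B < τ₀.im := by
      rw [him]
      have hlogB : Real.log ‖q‖ < -2 * Real.pi * B := by
        have := Real.log_lt_log hnorm hqB
        rwa [Real.log_exp] at this
      have : -1 / (2 * Real.pi) * Real.log ‖q‖ = -(Real.log ‖q‖) / (2 * Real.pi) := by ring
      rw [this, lt_div_iff₀ hπ]
      linarith
    let τ : ℍ := ⟨τ₀, him_pos⟩
    have hq : Function.Periodic.qParam 1 (τ : ℂ) = q := by
      show Function.Periodic.qParam 1 τ₀ = q
      rw [hτ₀]
      exact Function.Periodic.qParam_right_inv one_ne_zero hq0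
    have := h τ himB
    rwa [hq] at this
  rw [eventually_nhdsWithin_iff, Metric.eventually_nhds_iff]
  exact ⟨r, hr0, fun q hq hq0 ↦ hball q hq0 (by simpa [dist_zero_right] using hq)⟩

/-! ## §3 The series of `12℘_{Λ_W}(ℰ_f + κ)` for a half-period `κ` -/

/-- **The half-period family of series.**  There is a family `S : ℂ → ℂ⟦X⟧` — explicitly
`S e = 12e + (432e² − 36g₂)·X²·(P − 12e·X²)⁻¹` with `P` the INTEGER series of `𝕢²·12℘_{Λ_W}(ℰ_f)` and `g₂ = c₄(W)/12 ∈ ℚ` — such that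
(i) `(S e).map σ = S (σ e)` for every ring endomorphism `σ` of `ℂ` (the structure constants are rational), (ii) `S e` has constant term
`12e`, and (iii) for every HALF-PERIOD `κ` of `Λ_W` (`κ ∉ Λ_W`, `2κ ∈ Λ_W`), high in the cusp `ℰ_f τ + κ ∉ Λ_W` and
`Σₙ (S e_κ)ₙ 𝕢τⁿ = 12·℘_{Λ_W}(ℰ_f τ + κ)` with `e_κ = ℘_{Λ_W}(κ)` — the `q`-expansion of the translate `℘_{Λ_W}(ℰ_f + κ)` of the `c`-division
abscissa, from the half-period addition formula `℘(u + κ) = e_κ + (3e_κ² − g₂/4)/(℘(u) − e_κ)`. [cite: Lawden1989, §6.8 eq. (6.8.11)]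
[cite: SilvermanAEC2009, IV.1] -/
theorem exists_halfPeriodSeries (W : WeierstrassCurve ℚ) [W.IsElliptic] [W.IsGloballyMinimal] {N : ℕ} [NeZero N]
    (D : ModularParametrizationData W N) :
    ∃ S : ℂ → ℂ⟦X⟧, (∀ (σ : ℂ →+* ℂ) (e : ℂ), (S e).map σ = S (σ e)) ∧ (∀ e : ℂ, constantCoeff (S e) = 12 * e) ∧
      ∀ κ : ℂ, κ ∉ D.L.lattice → 2 * κ ∈ D.L.lattice → ∃ B : ℝ, ∀ τ : ℍ, B < τ.im →
        eichlerIntegral D.f τ + κ ∉ D.L.lattice ∧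
        HasSum (fun n : ℕ ↦ coeff n (S (℘[D.L] κ)) * Function.Periodic.qParam 1 (τ : ℂ) ^ n)
          (12 * ℘[D.L] (eichlerIntegral D.f τ + κ)) := by
  classical
  obtain ⟨T, P, B₀, hTan, hT0, hTP, hTval⟩ := exists_qGerm_sq_mul_twelve_weierstrassP W D
  have hf1 : cuspCoeff D.f 1 = 1 := D.isNewformOf.1.2.2
  -- `g₂ ∈ ℚ`
  have hg₂ : D.L.g₂ = ((W.c₄ / 12 : ℚ) : ℂ) := by
    rw [D.isNeronLattice.1]
    simp [WeierstrassCurve.baseChange, WeierstrassCurve.map_c₄]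
  set g : ℚ := W.c₄ / 12 with hgdef
  set Pc : ℂ⟦X⟧ := P.map (Int.castRingHom ℂ) with hPc
  have hPc0 : constantCoeff Pc = 12 := by
    rw [← hTP, constantCoeff_taylorAt0, hT0]
  have hPσ : ∀ σ : ℂ →+* ℂ, Pc.map σ = Pc := fun σ ↦ by
    ext n; simp only [hPc, coeff_map, eq_intCast, map_intCast]
  have hu : ∀ e : ℂ, constantCoeff (Pc - C (12 * e) * X ^ 2) ≠ 0 := fun e ↦ by
    rw [map_sub, map_mul, map_pow, constantCoeff_C, constantCoeff_X, hPc0]; norm_num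
  refine ⟨fun e ↦ C (12 * e) + C (432 * e ^ 2 - 36 * (g : ℂ)) * X ^ 2 * (Pc - C (12 * e) * X ^ 2)⁻¹, ?_, ?_, ?_⟩
  · intro σ e
    show (C (12 * e) + C (432 * e ^ 2 - 36 * (g : ℂ)) * X ^ 2 * (Pc - C (12 * e) * X ^ 2)⁻¹).map σ =
      C (12 * σ e) + C (432 * σ e ^ 2 - 36 * (g : ℂ)) * X ^ 2 * (Pc - C (12 * σ e) * X ^ 2)⁻¹
    rw [(PowerSeries.map σ).map_add, (PowerSeries.map σ).map_mul, (PowerSeries.map σ).map_mul,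
      map_inv_eq_inv_map σ _ (hu e), (PowerSeries.map σ).map_sub, (PowerSeries.map σ).map_mul,
      (PowerSeries.map σ).map_pow, map_C, map_C, map_X, hPσ σ]
    have h1 : σ (12 * e) = 12 * σ e := by rw [map_mul, map_ofNat]
    have h2 : σ (432 * e ^ 2 - 36 * (g : ℂ)) = 432 * σ e ^ 2 - 36 * (g : ℂ) := by
      rw [map_sub, map_mul, map_mul, map_pow, map_ofNat, map_ofNat, map_ratCast]
    rw [h1, h2]
  · intro e
    show constantCoeff (C (12 * e) + C (432 * e ^ 2 - 36 * (g : ℂ)) * X ^ 2 * (Pc - C (12 * e) * X ^ 2)⁻¹) = 12 * e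
    have h0 : constantCoeff (C (432 * e ^ 2 - 36 * (g : ℂ)) * X ^ 2 * (Pc - C (12 * e) * X ^ 2)⁻¹) = 0 := by
      rw [map_mul, map_mul, map_pow, constantCoeff_X]; simp
    rw [map_add, h0, add_zero, constantCoeff_C]
  intro κ hκ h2κ
  set e : ℂ := ℘[D.L] κ with he
  have hκ' : -κ ∉ D.L.lattice := fun h ↦ hκ (by simpa using neg_mem h)
  have h2κ' : 2 * (-κ) ∈ D.L.lattice := by rw [mul_neg]; exact neg_mem h2κ
  -- the germ `R(q) = 12℘(ε(q) + κ)`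
  set R : ℂ → ℂ := fun q ↦ 12 * ℘[D.L] (qGerm D.f q + κ) with hR
  have hεan : AnalyticAt ℂ (qGerm D.f) 0 := analyticAt_qGerm D.f
  have hε0 : qGerm D.f 0 = 0 := qGerm_zero D.f
  have hinner : AnalyticAt ℂ (fun q : ℂ ↦ qGerm D.f q + κ) 0 := hεan.add analyticAt_const
  have h℘an : AnalyticAt ℂ ℘[D.L] κ := D.L.analyticOnNhd_weierstrassP κ hκ
  have hcomp : AnalyticAt ℂ (fun q : ℂ ↦ ℘[D.L] (qGerm D.f q + κ)) 0 :=
    h℘an.comp_of_eq hinner (by simp [hε0])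
  have hRan : AnalyticAt ℂ R 0 := analyticAt_const.mul hcomp
  have hR0 : R 0 = 12 * e := by simp [hR, hε0, he]
  -- punctured neighbourhood: `ε ∉ Λ`, `ε ± κ ∉ Λ`, and the values of `T`
  have hev1 : ∀ᶠ q in 𝓝[≠] (0 : ℂ), qGerm D.f q ∉ D.L.lattice := eventually_qGerm_notMem D.f hf1 D.L
  have hcont : Tendsto (qGerm D.f) (𝓝 0) (𝓝 0) := by simpa [hε0] using hεan.continuousAt.tendsto
  have hev2 : ∀ᶠ q in 𝓝 (0 : ℂ), qGerm D.f q + κ ∉ D.L.lattice ∧ qGerm D.f q - κ ∉ D.L.lattice := by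
    have ho1 : IsOpen {w : ℂ | w + κ ∈ (D.L.lattice : Set ℂ)ᶜ} :=
      D.L.isClosed_lattice.isOpen_compl.preimage (continuous_id.add continuous_const)
    have ho2 : IsOpen {w : ℂ | w - κ ∈ (D.L.lattice : Set ℂ)ᶜ} :=
      D.L.isClosed_lattice.isOpen_compl.preimage (continuous_id.sub continuous_const)
    have hm1 : (0 : ℂ) ∈ {w : ℂ | w + κ ∈ (D.L.lattice : Set ℂ)ᶜ} := by simpa using hκ
    have hm2 : (0 : ℂ) ∈ {w : ℂ | w - κ ∈ (D.L.lattice : Set ℂ)ᶜ} := by simpa using hκ'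
    filter_upwards [hcont.eventually (ho1.mem_nhds hm1), hcont.eventually (ho2.mem_nhds hm2)] with q h1 h2
    exact ⟨h1, h2⟩
  have hev3 : ∀ᶠ q in 𝓝[≠] (0 : ℂ), T q = q ^ 2 * (12 * ℘[D.L] (qGerm D.f q)) :=
    eventually_nhdsNE_of_forall_im_gt (P := fun q ↦ T q = q ^ 2 * (12 * ℘[D.L] (qGerm D.f q)))
      fun τ hτ ↦ by rw [qGerm_apply]; exact (hTval τ hτ).2
  -- the identity `(R − 12e)·(T − 12e q²) = (432e² − 36g₂) q²` on the punctured neighbourhood, hence near `0`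
  have hident : ∀ᶠ q in 𝓝[≠] (0 : ℂ), (R q - 12 * e) * (T q - 12 * e * q ^ 2) = (432 * e ^ 2 - 36 * (g : ℂ)) * q ^ 2 := by
    filter_upwards [hev1, mem_nhdsWithin_of_mem_nhds hev2, hev3] with q hq1 hq2 hq3
    set u := qGerm D.f q with hu'
    have hsub := PeriodPair.weierstrassP_sub_halfPeriod (L := D.L) hκ' h2κ' hq1
      (by rw [sub_neg_eq_add]; exact hq2.1) (by rw [← sub_eq_add_neg]; exact hq2.2)
    rw [sub_neg_eq_add, D.L.weierstrassP_neg] at hsub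
    have hne : ℘[D.L] u - e ≠ 0 := by
      rw [he]
      intro h0
      rcases (D.L.weierstrassP_eq_weierstrassP_iff hq1 hκ).mp (sub_eq_zero.mp h0) with h' | h'
      · exact hq2.1 h'
      · exact hq2.2 h'
    rw [hR]
    simp only
    rw [hq3, hsub, ← he, hg₂]
    field_simp
    ring
  have hfe : (fun q ↦ (R q - 12 * e) * (T q - 12 * e * q ^ 2)) =ᶠ[𝓝 0] fun q ↦ (432 * e ^ 2 - 36 * (g : ℂ)) * q ^ 2 := by
    have hid : AnalyticAt ℂ (fun q : ℂ ↦ q) 0 := analyticAt_id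
    have ha : AnalyticAt ℂ (fun q ↦ (R q - 12 * e) * (T q - 12 * e * q ^ 2)) 0 :=
      (hRan.sub analyticAt_const).mul (hTan.sub (analyticAt_const.mul (hid.pow 2)))
    have hb : AnalyticAt ℂ (fun q : ℂ ↦ (432 * e ^ 2 - 36 * (g : ℂ)) * q ^ 2) 0 := analyticAt_const.mul (hid.pow 2)
    exact (ha.frequently_eq_iff_eventually_eq hb).mp hident.frequently
  -- Taylor series: `(𝓣[R] − 12e)·(P − 12e X²) = (432e² − 36g₂)·X²`
  have hid : AnalyticAt ℂ (fun q : ℂ ↦ q) 0 := analyticAt_id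
  have hTsq : taylorAt0 (fun q : ℂ ↦ q ^ 2) = X ^ 2 := by
    have h : (fun q : ℂ ↦ q ^ 2) = (fun q : ℂ ↦ q) ^ 2 := by funext q; simp
    rw [h]
    simp only [taylorAt0]
    rw [Literature.NumberTheory.Transcendental.AndreCriterion.taylor_pow hid 2]
    have := taylorAt0_id
    simp only [taylorAt0] at this
    rw [this]
  have hTay : (taylorAt0 R - C (12 * e)) * (Pc - C (12 * e) * X ^ 2) = C (432 * e ^ 2 - 36 * (g : ℂ)) * X ^ 2 := by
    have h := Literature.NumberTheory.Transcendental.AndreCriterion.taylor_congr hfe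
    have hA : AnalyticAt ℂ (fun q ↦ R q - 12 * e) 0 := hRan.sub analyticAt_const
    have hB : AnalyticAt ℂ (fun q ↦ T q - 12 * e * q ^ 2) 0 := hTan.sub (analyticAt_const.mul (hid.pow 2))
    have hmul : (fun q ↦ (R q - 12 * e) * (T q - 12 * e * q ^ 2)) = (fun q ↦ R q - 12 * e) * fun q ↦ T q - 12 * e * q ^ 2 := rfl
    rw [hmul] at h
    simp only [taylorAt0] at h hTP hTsq ⊢
    rw [Literature.NumberTheory.Transcendental.AndreCriterion.taylor_mul hA hB] at h
    have h1 : (PowerSeries.mk fun n ↦ ((n.factorial : ℂ))⁻¹ * iteratedDeriv n (fun q ↦ R q - 12 * e) 0) =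
        (PowerSeries.mk fun n ↦ ((n.factorial : ℂ))⁻¹ * iteratedDeriv n R 0) - C (12 * e) := by
      have := Literature.NumberTheory.EllipticCurves.taylor_sub hRan (analyticAt_const (v := 12 * e))
      rw [show (fun q ↦ R q - 12 * e) = R - fun _ ↦ 12 * e from rfl, this,
        Literature.NumberTheory.EllipticCurves.taylor_const]
    have h2 : (PowerSeries.mk fun n ↦ ((n.factorial : ℂ))⁻¹ * iteratedDeriv n (fun q ↦ T q - 12 * e * q ^ 2) 0) =
        Pc - C (12 * e) * X ^ 2 := by
      have hq2 : AnalyticAt ℂ (fun q : ℂ ↦ 12 * e * q ^ 2) 0 := analyticAt_const.mul (hid.pow 2)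
      have := Literature.NumberTheory.EllipticCurves.taylor_sub hTan hq2
      rw [show (fun q ↦ T q - 12 * e * q ^ 2) = T - fun q ↦ 12 * e * q ^ 2 from rfl, this, hTP,
        Literature.NumberTheory.Transcendental.AndreCriterion.taylor_const_mul, hTsq]
    have h3 : (PowerSeries.mk fun n ↦ ((n.factorial : ℂ))⁻¹ * iteratedDeriv n (fun q : ℂ ↦ (432 * e ^ 2 - 36 * (g : ℂ)) * q ^ 2) 0) =
        C (432 * e ^ 2 - 36 * (g : ℂ)) * X ^ 2 := by
      rw [Literature.NumberTheory.Transcendental.AndreCriterion.taylor_const_mul, hTsq]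
    rw [h1, h2, h3] at h
    exact h
  have hTR : taylorAt0 R = C (12 * e) + C (432 * e ^ 2 - 36 * (g : ℂ)) * X ^ 2 * (Pc - C (12 * e) * X ^ 2)⁻¹ := by
    have h := congrArg (fun φ ↦ φ * (Pc - C (12 * e) * X ^ 2)⁻¹) hTay
    rw [mul_assoc, PowerSeries.mul_inv_cancel _ (hu e), mul_one] at h
    rw [← h]; ring
  -- sum the Taylor series near `0`, then high in the cusp
  obtain ⟨r, hr, hsum⟩ := exists_hasSum_taylorAt0 hRan
  have hevS : ∀ᶠ q in 𝓝[≠] (0 : ℂ), HasSum (fun n : ℕ ↦ coeff n (taylorAt0 R) * q ^ n) (R q) ∧ qGerm D.f q + κ ∉ D.L.lattice := by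
    have h1 : ∀ᶠ q in 𝓝 (0 : ℂ), ‖q‖ < r := by
      have : Metric.ball (0 : ℂ) r ∈ 𝓝 (0 : ℂ) := Metric.ball_mem_nhds 0 hr
      filter_upwards [this] with q hq
      rwa [Metric.mem_ball, dist_zero_right] at hq
    filter_upwards [mem_nhdsWithin_of_mem_nhds (h1.and hev2)] with q hq
    exact ⟨hsum q hq.1, hq.2.1⟩
  obtain ⟨B, hB⟩ := exists_im_bound_of_eventually hevS
  refine ⟨B, fun τ hτ ↦ ?_⟩
  obtain ⟨hS, hΛ⟩ := hB τ hτ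
  rw [qGerm_apply] at hΛ
  refine ⟨hΛ, ?_⟩
  rw [hTR] at hS
  have hRτ : R (Function.Periodic.qParam 1 (τ : ℂ)) = 12 * ℘[D.L] (eichlerIntegral D.f τ + κ) := by
    simp only [hR, qGerm_apply]
  rw [hRτ] at hS
  exact hS

end Summit.BirchSwinnertonDyer.BirchSwinnertonDyer.Theorems.ManinLocalTwoThree.CDivTranslate

end
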